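import Mathlib.Analysis.SpecialFunctions.Pow.Real
import Mathlib.Analysis.SpecialFunctions.Log.Basic
import Mathlib.Analysis.SpecialFunctions.Sqrt
import Literature.Computability.Complexity.CliqueApproximatorsWide
import Literature.Computability.Complexity.CircuitLowerBoundsProofs
import HarnessLib

/-!
# Exponential monotone lower bound for `(k-1, k)`-clique functions, `k = ⌊√m⌋`

The lower-bound half of Tardos's exponential gap (Tardos 1988, p. 141, "Corollary
(A. A. Razborov; N. Alon and R. Boppana)" with `f(v) = ⌊√v⌋`; Jukna 2012, Thm. 9.26 and the
proof of Thm. 9.28, PDF pp. 283–286), PROVED for monotone Boolean circuits over `{∧₂, ∨₂}` in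
the exponent `m^{1/8}` that `Literature.Barriers.PneNP.Jukna2012_cliqueLike_sqrt_lowerBound`
asks for:

* `cliqueSqrt_monotone_lowerBound` — for all large `m`, every function `f` on the edges of
  `K_m` that accepts every `⌊√m⌋`-clique and rejects the complete multipartite graph of every
  `(⌊√m⌋ - 1)`-colouring has `2 ^ (m ^ (1/8)) ≤ C.size` for every circuit `C` over
  `monotoneBasis` computing `f`.

## Proof

Razborov's approximation method in the Alon–Boppana lattice `K(m, r, l)` in the wide regime
(`razborov_dichotomy_wide`, `CliqueApproximatorsWide.lean`) with `m = eᴸ`, clique size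
`s = k = ⌊√m⌋`, `g = k - 1` colours, `l = ⌊e^{L/8}⌋ = ⌊m^{1/8}⌋` and `r = ⌈e^{L/4 - 1}⌉`,
followed by two counting estimates with crude constants (Alon–Boppana 1987, §3.3–3.4 / proof
of Lemma 3.14; Jukna 2012, proof of Thm. 9.26):

* `caseA_bound_wide` (the approximator accepts everything): since `l² ≤ g e^{-L/8}`,
  Bernoulli's inequality gives `g(g-1)⋯(g-l+1) ≥ g^l (1 - l²/g) ≥ g^l (1 - e^{-L/8})`, so each
  OR gate wrongly accepts at most a fraction `|𝒱(l)| e^{-rL/8}` of the `g^m` colourings, whence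
  `t ≥ e^{rL/8} / (m+1)^l ≥ exp((L/8) e^{L/4-1} - (L+1) e^{L/8}) ≥ exp(e^{L/8})`;
* `caseB_bound_wide` (every `s`-clique is lost at an AND gate or contains a minimal member):
  `C(m,s) ≤ 2 t ρ^{2l} C(m-l-1, s-l-1)` with `ρ = r - 1`, and
  `C(m-l-1, s-l-1) ≤ C(m,s) (s/m)^{l+1}`, `ρ² s/m ≤ e^{-2}`, whence `t ≥ e^{2l}/2 ≥ exp(e^{L/8})`.

Both use only `1 + y ≤ eʸ`; the threshold is `L ≥ 88`. The exponent `m^{1/8}` is Jukna's (the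
argument gives `2^{Ω(m^{1/4}/log m)}`, Alon–Boppana / Tardos's `exp(c f(v)^{1/2})`; not needed).

## References

* É. Tardos, *The gap between monotone and non-monotone circuit complexity is exponential*,
  Combinatorica 8 (1988) 141–142, p. 141 (Corollary) [Tardos1988].
* N. Alon, R. B. Boppana, *The monotone circuit complexity of Boolean functions*,
  Combinatorica 7 (1987) 1–22, Thm. 2.1, Lemma 3.13, Lemma 3.14, §3.4 [AlonBoppana1987].
* S. Jukna, *Boolean Function Complexity* (2012), Thm. 9.26 and proof of Thm. 9.28
  (PDF pp. 283–286) [Jukna2012].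
-/

namespace Literature.Computability.Complexity

open Finset Razborov Real Filter

/-! ### An elementary falling-factorial estimate -/

/-- `g^l (1 - l²/g) ≤ g(g-1)⋯(g-l+1)` for `l ≤ g`, `g > 0`: Bernoulli's inequality
`1 + l a ≤ (1 + a)^l` with `a = (1 - l)/g`, applied to `(g + 1 - l)^l ≤ g(g-1)⋯(g-l+1)`.
[folklore] -/
theorem pow_mul_one_sub_le_descFactorial {g l : ℕ} (hlg : l ≤ g) (hg : 0 < g) :
    (g : ℝ) ^ l * (1 - (l : ℝ) * l / g) ≤ (g.descFactorial l : ℝ) := by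
  have hg' : (0 : ℝ) < g := by exact_mod_cast hg
  have hl0 : (0 : ℝ) ≤ l := Nat.cast_nonneg l
  have hlg' : (l : ℝ) ≤ g := by exact_mod_cast hlg
  have h1 : (((g + 1 - l : ℕ) : ℝ)) ^ l ≤ (g.descFactorial l : ℝ) := by
    exact_mod_cast Nat.pow_sub_le_descFactorial g l
  have hcast : ((g + 1 - l : ℕ) : ℝ) = (g : ℝ) * (1 + (1 - l) / g) := by
    rw [Nat.cast_sub (by omega : l ≤ g + 1)]; push_cast; field_simp; ring
  have hB : 1 + (l : ℝ) * ((1 - l) / g) ≤ (1 + (1 - l) / g) ^ l := by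
    refine one_add_mul_le_pow ?_ l
    rw [le_div_iff₀ hg']
    linarith
  have hkey : 1 - (l : ℝ) * l / g ≤ 1 + (l : ℝ) * ((1 - l) / g) := by
    have h2 : (l : ℝ) * ((1 - l) / g) = l / g - (l : ℝ) * l / g := by ring
    have h3 : (0 : ℝ) ≤ l / g := div_nonneg hl0 hg'.le
    linarith
  calc (g : ℝ) ^ l * (1 - (l : ℝ) * l / g)
      ≤ (g : ℝ) ^ l * (1 + (l : ℝ) * ((1 - l) / g)) :=
        mul_le_mul_of_nonneg_left hkey (by positivity)
    _ ≤ (g : ℝ) ^ l * (1 + (1 - l) / g) ^ l := mul_le_mul_of_nonneg_left hB (by positivity)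
    _ = ((g : ℝ) * (1 + (1 - l) / g)) ^ l := by rw [mul_pow]
    _ = (((g + 1 - l : ℕ) : ℝ)) ^ l := by rw [hcast]
    _ ≤ _ := h1

/-! ### Case 2 (the approximator is `≡ 1`): `t ≥ e^{rL/8} / (m+1)^l` -/

/-- **Case 2 of the final count, wide regime** (Alon–Boppana 1987, proof of Lemma 3.14,
Case 2, crude constants): with `m = eᴸ`, `L ≥ 88`, `g ≥ e^{L/2} - 2` colours, `l ≤ e^{L/8}`,
`r ≥ e^{L/4 - 1}` and `N ≤ (m+1)^l`, the inequality
`g^m (g^l)^r ≤ t · N · (g^l - g(g-1)⋯(g-l+1))^r · g^m` forces `t ≥ exp(e^{L/8})`.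
[cite: AlonBoppana1987, Lemma 3.14] -/
theorem caseA_bound_wide {m g l r N t : ℕ} {L : ℝ} (hL : 88 ≤ L) (hm : (m : ℝ) = exp L)
    (hg : exp (L / 2) - 2 ≤ g) (hl : (l : ℝ) ≤ exp (L / 8)) (hr : exp (L / 4 - 1) ≤ r)
    (hN : (N : ℝ) ≤ ((m : ℝ) + 1) ^ l)
    (h : g ^ m * (g ^ l) ^ r ≤ t * (N * ((g ^ l - g.descFactorial l) ^ r * g ^ m))) :
    exp (exp (L / 8)) ≤ t := by
  set E : ℝ := exp (L / 8) with hE_def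
  have hEpos : 0 < E := exp_pos _
  have hE : 12 ≤ E := by have := add_one_le_exp (L / 8); rw [← hE_def] at this; linarith
  have hE4 : exp (L / 4) = E ^ 2 := by rw [hE_def, sq, ← exp_add]; ring_nf
  have hE2 : exp (L / 2) = E ^ 4 := by
    have h1 : exp (L / 2) = exp (L / 4) * exp (L / 4) := by rw [← exp_add]; ring_nf
    rw [h1, hE4]; ring
  -- `g` is large
  have hgE : E ^ 4 - 2 ≤ g := by rw [← hE2]; exact hg
  have hE1 : 1 ≤ E := by linarith
  have hE3one : 1 ≤ E ^ 3 := one_le_pow₀ hE1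
  have hE43 : 12 * E ^ 3 ≤ E ^ 4 := by
    rw [show E ^ 4 = E * E ^ 3 by ring]
    exact mul_le_mul_of_nonneg_right hE (by positivity)
  have hE3g : E ^ 3 ≤ g := by linarith
  have hEg : E ≤ g := (le_self_pow₀ hE1 (by norm_num : (3 : ℕ) ≠ 0)).trans hE3g
  have hg1 : (1 : ℝ) ≤ g := by linarith
  have hgpos : (0 : ℝ) < g := by linarith
  have hg0 : 0 < g := by exact_mod_cast hgpos
  have hlg' : (l : ℝ) ≤ g := hl.trans hEg
  have hlg : l ≤ g := by exact_mod_cast hlg'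
  -- the players as reals
  set a : ℝ := (g : ℝ) ^ l with ha_def
  set d : ℝ := (g.descFactorial l : ℝ) with hd_def
  have ha : 0 < a := by positivity
  have hdle : g.descFactorial l ≤ g ^ l := Nat.descFactorial_le_pow g l
  have hda : d ≤ a := by rw [hd_def, ha_def]; exact_mod_cast hdle
  -- cast the hypothesis and cancel `g^m`
  have hR : (g : ℝ) ^ m * a ^ r ≤ t * (N * ((a - d) ^ r * (g : ℝ) ^ m)) := by
    have := (Nat.cast_le (α := ℝ)).2 h
    push_cast [Nat.cast_sub hdle] at this
    exact this
  have hgm : 0 < (g : ℝ) ^ m := by positivity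
  have h1 : a ^ r ≤ t * N * (a - d) ^ r := by
    rw [show (t : ℝ) * (N * ((a - d) ^ r * (g : ℝ) ^ m)) = (t * N * (a - d) ^ r) * (g : ℝ) ^ m by
      ring, mul_comm] at hR
    exact le_of_mul_le_mul_right hR hgm
  -- `a - d ≤ a / E`
  have hdesc : a * (1 - (l : ℝ) * l / g) ≤ d := pow_mul_one_sub_le_descFactorial hlg hg0
  have hll : (l : ℝ) * l / g ≤ E⁻¹ := by
    rw [div_le_iff₀ hgpos]
    calc (l : ℝ) * l ≤ E * E := mul_le_mul hl hl (Nat.cast_nonneg l) hEpos.le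
      _ = E⁻¹ * E ^ 3 := by field_simp
      _ ≤ E⁻¹ * g := mul_le_mul_of_nonneg_left hE3g (inv_nonneg.2 hEpos.le)
  have had : a - d ≤ a * E⁻¹ := by
    have h2 : a * (1 - (l : ℝ) * l / g) = a - a * ((l : ℝ) * l / g) := by ring
    have h3 : a - d ≤ a * ((l : ℝ) * l / g) := by linarith
    exact h3.trans (mul_le_mul_of_nonneg_left hll ha.le)
  have h0ad : 0 ≤ a - d := by linarith
  have h2 : (a - d) ^ r ≤ a ^ r * (E⁻¹) ^ r := by
    rw [← mul_pow]; exact pow_le_pow_left₀ h0ad had r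
  -- hence `E^r ≤ t N`
  have h3 : 1 * a ^ r ≤ (t * N * (E⁻¹) ^ r) * a ^ r := by
    calc 1 * a ^ r = a ^ r := one_mul _
      _ ≤ t * N * (a - d) ^ r := h1
      _ ≤ t * N * (a ^ r * (E⁻¹) ^ r) := mul_le_mul_of_nonneg_left h2 (by positivity)
      _ = (t * N * (E⁻¹) ^ r) * a ^ r := by ring
  have h4 : 1 ≤ t * N * (E⁻¹) ^ r := le_of_mul_le_mul_right h3 (pow_pos ha r)
  have h5 : E ^ r ≤ t * N := by
    have hEr : 0 < E ^ r := pow_pos hEpos r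
    have := mul_le_mul_of_nonneg_right h4 hEr.le
    rwa [one_mul, mul_assoc, ← mul_pow, inv_mul_cancel₀ hEpos.ne', one_pow, mul_one] at this
  -- `E^r = exp(r L/8) ≥ exp((L/8) e^{L/4 - 1})`
  have hEr : exp (L / 8 * exp (L / 4 - 1)) ≤ E ^ r := by
    rw [hE_def, ← exp_nat_mul]
    refine exp_le_exp.2 ?_
    rw [mul_comm (r : ℝ)]
    exact mul_le_mul_of_nonneg_left hr (by linarith)
  -- `N ≤ exp((L+1) E)`
  have hN' : (N : ℝ) ≤ exp ((L + 1) * E) := by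
    have hm1 : (m : ℝ) + 1 ≤ exp (L + 1) := by
      rw [exp_add, hm]
      have h2e : (2 : ℝ) ≤ exp 1 := by linarith [add_one_le_exp (1 : ℝ)]
      have h1e : (1 : ℝ) ≤ exp L := one_le_exp (by linarith)
      have h3 := mul_le_mul_of_nonneg_left h2e (exp_pos L).le
      linarith
    calc (N : ℝ) ≤ ((m : ℝ) + 1) ^ l := hN
      _ ≤ (exp (L + 1)) ^ l := pow_le_pow_left₀ (by positivity) hm1 l
      _ = exp ((L + 1) * l) := by rw [← exp_nat_mul]; ring_nf
      _ ≤ exp ((L + 1) * E) := exp_le_exp.2 (mul_le_mul_of_nonneg_left hl (by linarith))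
  -- combine
  have ht0 : (0 : ℝ) ≤ t := Nat.cast_nonneg t
  have h6 : exp (L / 8 * exp (L / 4 - 1)) ≤ t * exp ((L + 1) * E) :=
    hEr.trans (h5.trans (mul_le_mul_of_nonneg_left hN' ht0))
  have h7 : exp (L / 8 * exp (L / 4 - 1) - (L + 1) * E) ≤ t := by
    rw [exp_sub, div_le_iff₀ (exp_pos _)]
    exact h6
  refine le_trans (exp_le_exp.2 ?_) h7
  -- `E ≤ (L/8) e^{L/4-1} - (L+1) E`, using `e^{L/4-1} = E e^{L/8-1} ≥ E L/8`
  have h8 : exp (L / 4 - 1) = E * exp (L / 8 - 1) := by rw [hE_def, ← exp_add]; ring_nf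
  have h9 : L / 8 ≤ exp (L / 8 - 1) := by linarith [add_one_le_exp (L / 8 - 1)]
  have h10 : L / 8 * (E * (L / 8)) ≤ L / 8 * (E * exp (L / 8 - 1)) :=
    mul_le_mul_of_nonneg_left (mul_le_mul_of_nonneg_left h9 hEpos.le) (by linarith)
  have hLL : (1 : ℝ) ≤ L / 8 * (L / 8) - L - 1 := by nlinarith
  have h11 : E * 1 ≤ E * (L / 8 * (L / 8) - L - 1) := mul_le_mul_of_nonneg_left hLL hEpos.le
  have h12 : L / 8 * (E * (L / 8)) = E * (L / 8 * (L / 8)) := by ring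
  rw [h8]
  linarith [h10, h11, h12]

/-! ### Case 1 (few minimal sets): `t ≥ e^{2l} / 2` -/

/-- **Case 1 of the final count, wide regime** (Alon–Boppana 1987, proof of Lemma 3.14 /
§3.4, crude constants): with `m = eᴸ`, `L ≥ 88`, `l < s ≤ e^{L/2}`, `e^{L/8} ≤ l + 1` and
`ρ ≤ e^{L/4 - 1}`, the inequality
`C(m,s) ≤ t ρ^{2l} C(m-l-1, s-l-1) + Σ_{2≤k≤l} ρᵏ C(m-k, s-k)` forces `t ≥ exp(e^{L/8})`.
[cite: AlonBoppana1987, Lemma 3.14] -/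
theorem caseB_bound_wide {m s l ρ t : ℕ} {L : ℝ} (hL : 88 ≤ L) (hm : (m : ℝ) = exp L)
    (hs : (s : ℝ) ≤ exp (L / 2)) (hls : l < s) (hl : exp (L / 8) ≤ l + 1)
    (hρ : (ρ : ℝ) ≤ exp (L / 4 - 1))
    (h : m.choose s ≤ t * ((ρ ^ l) ^ 2 * (m - (l + 1)).choose (s - (l + 1))) +
      ∑ k ∈ Icc 2 l, ρ ^ k * (m - k).choose (s - k)) :
    exp (exp (L / 8)) ≤ t := by
  set E : ℝ := exp (L / 8) with hE_def
  have hEpos : 0 < E := exp_pos _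
  have hE : 12 ≤ E := by have := add_one_le_exp (L / 8); rw [← hE_def] at this; linarith
  have hmpos : (0 : ℝ) < m := by rw [hm]; exact exp_pos L
  have hm0 : 0 < m := by exact_mod_cast hmpos
  have hsm : s ≤ m := by
    have : (s : ℝ) ≤ m := hs.trans (by rw [hm]; exact exp_le_exp.2 (by linarith))
    exact_mod_cast this
  have hρ0 : (0 : ℝ) ≤ ρ := Nat.cast_nonneg ρ
  have hs0 : (0 : ℝ) ≤ s := Nat.cast_nonneg s
  -- the error sum is at most half
  have hρs : (ρ : ℝ) * s ≤ exp (3 * L / 4 - 1) := by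
    calc (ρ : ℝ) * s ≤ exp (L / 4 - 1) * exp (L / 2) := mul_le_mul hρ hs hs0 (exp_nonneg _)
      _ = exp (3 * L / 4 - 1) := by rw [← exp_add]; ring_nf
  have hx : (ρ : ℝ) * s / m ≤ 1 := by
    rw [div_le_one hmpos, hm]
    exact hρs.trans (exp_le_exp.2 (by linarith))
  have he2 : exp (-2) ≤ 1 / 2 := by
    have h3 : (2 : ℝ) ≤ exp 2 := by linarith [add_one_le_exp (2 : ℝ)]
    rw [exp_neg, one_div]
    exact inv_anti₀ two_pos h3
  have hx2 : (s : ℝ) * ((ρ : ℝ) * s / m) ^ 2 ≤ 1 / 2 := by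
    have h1 : (s : ℝ) * ((ρ : ℝ) * s / m) ^ 2 = s * (ρ * s) ^ 2 / (m : ℝ) ^ 2 := by
      field_simp
    rw [h1, div_le_iff₀ (by positivity), hm]
    have h2 : (s : ℝ) * ((ρ : ℝ) * s) ^ 2 ≤ exp (L / 2) * (exp (3 * L / 4 - 1)) ^ 2 :=
      mul_le_mul hs (pow_le_pow_left₀ (by positivity) hρs 2) (by positivity) (by positivity)
    have h3 : exp (L / 2) * (exp (3 * L / 4 - 1)) ^ 2 = exp (-2) * exp L ^ 2 := by
      rw [sq, sq, ← exp_add, ← exp_add, ← exp_add, ← exp_add]; ring_nf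
    calc (s : ℝ) * ((ρ : ℝ) * s) ^ 2 ≤ exp (L / 2) * (exp (3 * L / 4 - 1)) ^ 2 := h2
      _ = exp (-2) * exp L ^ 2 := h3
      _ ≤ 1 / 2 * exp L ^ 2 := mul_le_mul_of_nonneg_right he2 (by positivity)
  have hsum := sum_choose_sub_le_half hρ0 hls.le hsm hm0 hx hx2
  -- cast the hypothesis
  have hR : (m.choose s : ℝ) ≤ t * (((ρ : ℝ) ^ l) ^ 2 * ((m - (l + 1)).choose (s - (l + 1)) : ℝ)) +
      ∑ k ∈ Icc 2 l, (ρ : ℝ) ^ k * ((m - k).choose (s - k) : ℝ) := by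
    exact_mod_cast h
  have hC : (m.choose s : ℝ) ≤
      2 * t * (((ρ : ℝ) ^ l) ^ 2 * ((m - (l + 1)).choose (s - (l + 1)) : ℝ)) := by
    linarith
  -- `C(m-l-1, s-l-1) ≤ C(m,s) (s/m)^{l+1}` and `C(m,s) > 0`
  have hch : ((m - (l + 1)).choose (s - (l + 1)) : ℝ) ≤ m.choose s * ((s : ℝ) / m) ^ (l + 1) :=
    cast_choose_sub_le (by omega) hsm hm0
  have hCpos : (0 : ℝ) < m.choose s := by exact_mod_cast Nat.choose_pos hsm
  have ht0 : (0 : ℝ) ≤ t := Nat.cast_nonneg t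
  have h1 : 1 * (m.choose s : ℝ) ≤
      (2 * t * (((ρ : ℝ) ^ l) ^ 2 * ((s : ℝ) / m) ^ (l + 1))) * m.choose s := by
    calc 1 * (m.choose s : ℝ) = m.choose s := one_mul _
      _ ≤ 2 * t * (((ρ : ℝ) ^ l) ^ 2 * ((m - (l + 1)).choose (s - (l + 1)) : ℝ)) := hC
      _ ≤ 2 * t * (((ρ : ℝ) ^ l) ^ 2 * (m.choose s * ((s : ℝ) / m) ^ (l + 1))) :=
          mul_le_mul_of_nonneg_left (mul_le_mul_of_nonneg_left hch (by positivity))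
            (by positivity)
      _ = _ := by ring
  have h2 : 1 ≤ 2 * t * (((ρ : ℝ) ^ l) ^ 2 * ((s : ℝ) / m) ^ (l + 1)) :=
    le_of_mul_le_mul_right h1 hCpos
  -- `ρ^{2l} (s/m)^{l+1} ≤ (ρ² s/m)^l ≤ e^{-2l}`
  have hsm' : (s : ℝ) / m ≤ 1 := by rw [div_le_one hmpos]; exact_mod_cast hsm
  have hsm0 : 0 ≤ (s : ℝ) / m := by positivity
  have hbase : (ρ : ℝ) ^ 2 * ((s : ℝ) / m) ≤ exp (-2) := by
    have h3 : (ρ : ℝ) ^ 2 * s ≤ exp (L / 2 - 2) * exp (L / 2) := by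
      refine mul_le_mul ?_ hs hs0 (by positivity)
      calc (ρ : ℝ) ^ 2 ≤ (exp (L / 4 - 1)) ^ 2 := pow_le_pow_left₀ hρ0 hρ 2
        _ = exp (L / 2 - 2) := by rw [sq, ← exp_add]; ring_nf
    rw [hm, ← mul_div_assoc, div_le_iff₀ (exp_pos L)]
    calc (ρ : ℝ) ^ 2 * s ≤ exp (L / 2 - 2) * exp (L / 2) := h3
      _ = exp (-2) * exp L := by rw [← exp_add, ← exp_add]; ring_nf
  have hb0 : 0 ≤ (ρ : ℝ) ^ 2 * ((s : ℝ) / m) := by positivity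
  have h3 : ((ρ : ℝ) ^ l) ^ 2 * ((s : ℝ) / m) ^ (l + 1) ≤ exp (-2) ^ l := by
    calc ((ρ : ℝ) ^ l) ^ 2 * ((s : ℝ) / m) ^ (l + 1)
        = ((ρ : ℝ) ^ 2 * ((s : ℝ) / m)) ^ l * ((s : ℝ) / m) := by ring
      _ ≤ ((ρ : ℝ) ^ 2 * ((s : ℝ) / m)) ^ l * 1 :=
          mul_le_mul_of_nonneg_left hsm' (by positivity)
      _ ≤ exp (-2) ^ l * 1 := mul_le_mul_of_nonneg_right (pow_le_pow_left₀ hb0 hbase l) zero_le_one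
      _ = exp (-2) ^ l := mul_one _
  -- `1 ≤ 2 t e^{-2l}`, so `e^{2l} ≤ 2 t ≤ e t`
  have h4 : 1 ≤ 2 * t * exp (-2) ^ l := h2.trans (mul_le_mul_of_nonneg_left h3 (by positivity))
  have h5 : exp (2 * l) ≤ 2 * t := by
    have he : exp (-2) ^ l = (exp (2 * l))⁻¹ := by
      rw [← exp_nat_mul, ← exp_neg]; ring_nf
    rw [he] at h4
    have hpos := exp_pos (2 * (l : ℝ))
    have := mul_le_mul_of_nonneg_right h4 hpos.le
    rwa [one_mul, mul_assoc, inv_mul_cancel₀ hpos.ne', mul_one] at this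
  have h2e : (2 : ℝ) ≤ exp 1 := by linarith [add_one_le_exp (1 : ℝ)]
  have h6 : exp (2 * l - 1) ≤ t := by
    rw [exp_sub, div_le_iff₀ (exp_pos 1)]
    have h7 := mul_le_mul_of_nonneg_left h2e ht0
    calc exp (2 * l) ≤ 2 * t := h5
      _ ≤ t * exp 1 := by linarith
  refine le_trans (exp_le_exp.2 ?_) h6
  have : E ≤ (l : ℝ) + 1 := hl
  linarith

/-! ### The lower bound -/

/-- **Exponential monotone lower bound for `(⌊√m⌋ - 1, ⌊√m⌋)`-clique functions** (Tardos 1988,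
p. 141, Corollary (Razborov; Alon–Boppana) with `f(v) = ⌊√v⌋`; Jukna 2012, Thm. 9.26 / proof
of Thm. 9.28: "any monotone … circuit requires `2^{Ω(n^{1/8})}` gates"). For all large `m`:
if `f` accepts the clique vector of every `⌊√m⌋`-set and rejects the complete multipartite
graph of every `(⌊√m⌋ - 1)`-colouring, then every circuit over `{∧₂, ∨₂}` computing `f` has at
least `2 ^ (m ^ (1/8))` gates. Proof: `razborov_dichotomy_wide` with `l = ⌊m^{1/8}⌋`,
`r = ⌈m^{1/4}/e⌉`, then `caseA_bound_wide` / `caseB_bound_wide`.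
[cite: Tardos1988, p. 141 (Corollary)] [cite: Jukna2012, Thm. 9.26 and Thm. 9.28 (PDF pp. 283–286)] [cite: AlonBoppana1987, Lemma 3.14] -/
theorem cliqueSqrt_monotone_lowerBound :
    ∀ᶠ m : ℕ in atTop, ∀ f : (KEdge m → Bool) → Bool,
      (∀ Z : Finset (Fin m), #Z = Nat.sqrt m → f (cliqueVec Z) = true) →
      (∀ O : Fin m → Fin (Nat.sqrt m - 1), f (colorVec O) = false) →
      ∀ C : Circuit (KEdge m), C.IsOver monotoneBasis → C.Computes f →
        (2 : ℝ) ^ ((m : ℝ) ^ (1 / 8 : ℝ)) ≤ (C.size : ℝ) := by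
  rw [eventually_atTop]
  refine ⟨⌈exp 88⌉₊, fun m hm f hpos hneg C hCB hCf => ?_⟩
  -- `m = eᴸ`, `L ≥ 88`, `E = e^{L/8}`
  have hm88 : exp 88 ≤ (m : ℝ) := (Nat.le_ceil _).trans (by exact_mod_cast hm)
  have hmpos : (0 : ℝ) < m := (exp_pos _).trans_le hm88
  set L : ℝ := Real.log m with hL_def
  have hmL : (m : ℝ) = exp L := (exp_log hmpos).symm
  have hL : 88 ≤ L := by rwa [hL_def, le_log_iff_exp_le hmpos]
  set E : ℝ := exp (L / 8) with hE_def
  have hEpos : 0 < E := exp_pos _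
  have hE : 12 ≤ E := by have := add_one_le_exp (L / 8); rw [← hE_def] at this; linarith
  have hE4 : exp (L / 4) = E ^ 2 := by rw [hE_def, sq, ← exp_add]; ring_nf
  have hE2 : exp (L / 2) = E ^ 4 := by
    have h1 : exp (L / 2) = exp (L / 4) * exp (L / 4) := by rw [← exp_add]; ring_nf
    rw [h1, hE4]; ring
  have hE1 : 1 ≤ E := by linarith
  have hEE : E + 2 ≤ E ^ 4 := by
    have h1 : E + 2 ≤ E ^ 2 := by nlinarith
    exact h1.trans (pow_le_pow_right₀ hE1 (by norm_num))
  -- `k = ⌊√m⌋`: `e^{L/2} - 1 < k ≤ e^{L/2}`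
  set k : ℕ := Nat.sqrt m with hk_def
  have hsqrt : Real.sqrt m = exp (L / 2) := by
    rw [hmL, show exp L = exp (L / 2) ^ 2 by rw [sq, ← exp_add]; ring_nf,
      Real.sqrt_sq (exp_pos _).le]
  have hk_le : (k : ℝ) ≤ exp (L / 2) := by
    have h1 : (k : ℝ) ≤ Real.sqrt m := Real.nat_sqrt_le_real_sqrt
    rwa [hsqrt] at h1
  have hk_gt : exp (L / 2) < k + 1 := by
    have h1 : Real.sqrt m < k + 1 := Real.real_sqrt_lt_nat_sqrt_succ
    rwa [hsqrt] at h1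
  have hkE : E + 2 < (k : ℝ) + 1 := by rw [hE2] at hk_gt; exact hEE.trans_lt hk_gt
  have hk1 : 1 ≤ k := by
    have : (1 : ℝ) ≤ k := by linarith
    exact_mod_cast this
  have hg : exp (L / 2) - 2 ≤ ((k - 1 : ℕ) : ℝ) := by
    rw [Nat.cast_sub hk1]; push_cast; linarith
  -- `l = ⌊E⌋`
  set l : ℕ := ⌊E⌋₊ with hl_def
  have hlE : (l : ℝ) ≤ E := Nat.floor_le hEpos.le
  have hEl : E < l + 1 := Nat.lt_floor_add_one E
  have hl2 : 2 ≤ l := by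
    have : (10 : ℝ) < l := by linarith
    have : 10 < l := by exact_mod_cast this
    omega
  have hlk : l < k := by
    have : (l : ℝ) < k := by linarith
    exact_mod_cast this
  -- `r = ⌈e^{L/4 - 1}⌉`
  set r : ℕ := ⌈exp (L / 4 - 1)⌉₊ with hr_def
  have hr : exp (L / 4 - 1) ≤ r := Nat.le_ceil _
  have hr2 : 2 ≤ r := by
    have h1 : (2 : ℝ) ≤ exp (L / 4 - 1) := by linarith [add_one_le_exp (L / 4 - 1)]
    have h2 : (2 : ℝ) ≤ r := h1.trans hr
    exact_mod_cast h2
  have hρ : ((r - 1 : ℕ) : ℝ) ≤ exp (L / 4 - 1) := by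
    have h1 : ((r - 1 : ℕ) : ℝ) = r - 1 := by push_cast [Nat.cast_sub (by omega : 1 ≤ r)]; ring
    rw [h1]
    linarith [Nat.ceil_lt_add_one (exp_nonneg (L / 4 - 1))]
  -- the target in exponential form: `2^{m^{1/8}} ≤ exp E`
  have htarget : (2 : ℝ) ^ ((m : ℝ) ^ (1 / 8 : ℝ)) ≤ exp E := by
    have h1 : (m : ℝ) ^ (1 / 8 : ℝ) = E := by
      rw [rpow_def_of_pos hmpos, ← hL_def, hE_def]
      ring_nf
    rw [h1, rpow_def_of_pos two_pos]
    refine exp_le_exp.2 ?_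
    have hlog2 : Real.log 2 ≤ 1 := by
      rw [Real.log_le_iff_le_exp two_pos]
      linarith [add_one_le_exp (1 : ℝ)]
    have := mul_le_mul_of_nonneg_right hlog2 hEpos.le
    linarith
  refine htarget.trans ?_
  -- Razborov's dichotomy, wide regime
  rcases razborov_dichotomy_wide (r := r) (l := l) (s := k) (g := k - 1) hr2 hl2 hlk C hCB hCf
      hpos hneg with hA | hB
  · -- Case 2: the approximator accepts everything
    refine caseA_bound_wide hL hmL hg hlE hr ?_ hA
    have h := card_smallSets_le (α := Fin m) l
    rw [Fintype.card_fin] at h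
    exact_mod_cast h
  · -- Case 1: few minimal sets
    exact caseB_bound_wide (ρ := r - 1) hL hmL hk_le hlk hEl.le hρ hB

end Literature.Computability.Complexity
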